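import Mathlib.Analysis.InnerProductSpace.LinearPMap
import Literature.Analysis.FluidPDE.LerayProjector
import Literature.Analysis.FluidPDE.StokesTorus
import Literature.Analysis.FunctionSpaces.Complexify
import Literature.Analysis.FunctionSpaces.TorusSobolevNorm
import Literature.Analysis.FunctionSpaces.TorusSobolevSpace
import Literature.Analysis.UnboundedOperators.SymmetricPMap
import Literature.Analysis.UnboundedOperators.DiagonalOperator
import HarnessLib

-- provenance: harness21/H21/H21/Statements/NS/EnergySpaceTorus.lean @ 53e468a (interim HEAD d8f2665); M5 mechanical rewrite
/-!
# NS: the energy space on the torus, the Stokes operator, its eigenbasis, Galerkin truncations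

Family: NS (Navier–Stokes), trunk FluidKinetic (outline `H21/Outlines/FluidKinetic.md`,
`Statements/NS/EnergySpaceTorus.lean`). Inventory id **ns.S33** (definition role):

> energy space on `T^3`: `L²_σ / H`, `V = H ∩ H¹`, Stokes operator `A = -P Δ`, its eigenbasis
> and Galerkin truncations (used in Leray–Hopf existence and in turb-zeroth).

All the *data* is accepted H21 prelude: `Torus.energySpace d = H`, `Torus.energySpaceV d = V`
(`Literature.Prelude.Sobolev.TorusSobolevSpace`), `Torus.lerayProjector d = P`
(`Literature.Prelude.FluidKinetic.LerayProjector`), `Torus.stokesOperator d = A`,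
`Torus.stokesModeL2`, `Torus.stokesEigenvalue`, `Torus.galerkinSpace`, `Torus.galerkinProj`
(`Literature.Prelude.FluidKinetic.StokesTorus`), and the unbounded-operator vocabulary
`LinearPMap.IsPositive`, `LinearPMap.HasEigenvector`, `HilbertBasis.diagonalDomain`,
`HilbertBasis.diagonalPMap` (`Literature.Prelude.UnbddOp.*`). This file records, under the inventory
id, the package of facts that make up the "energy space set-up" of Constantin–Foias, Ch. 4, for a
general finite index type `d` (physical case `d = Fin 3`):

* `NS.energySpace_characterisation` — `H = {v ∈ L² | div v = 0 weakly, ∫ v = 0}`;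
* `NS.energySpaceV_eq` — `V = H ∩ H¹` (definitional);
* `NS.stokesOperator_isSelfAdjoint_isPositive` — `A = A* ≥ 0`;
* `NS.stokes_eigenbasis_complete` — the Stokes modes `a cos(2πk·x)`, `a sin(2πk·x)`, `k ≠ 0`,
  `a ⊥ k`, are eigenvectors of `A` (eigenvalue `4π²|k|²`) spanning a dense subspace of `H`;
* `NS.exists_hilbertBasis_stokes` — `H` has a Hilbert basis of Stokes modes in which `A` is the
  maximal diagonal operator `HilbertBasis.diagonalPMap` (bridge to the UnbddOp trunk);
* `NS.galerkin_convergence` — `P_N v → v` for `v ∈ H`;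
* `NS.lerayProjector_comm_galerkinProj` — `P_N P = P P_N = P_N`.

## Mathlib search

Mathlib (this pin) has `LinearPMap`, its adjoint and `IsSelfAdjoint`
(`Mathlib.Analysis.InnerProductSpace.LinearPMap`), `HilbertBasis`, `Submodule.starProjection`,
`Dense`, `Filter.Tendsto`; it has no Stokes operator, solenoidal space, Leray projector or
Galerkin truncation (grep `Stokes|solenoidal|Leray|Galerkin`: nothing). Nothing is defined here;
every statement is about accepted H21 objects.

## Design notes

* `energySpace_characterisation` restates the accepted (sorried) `Torus.mem_energySpace_iff`
  under the inventory id and is proved from it; `energySpaceV_eq` is `Iff.rfl`;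
  `stokesOperator_isSelfAdjoint_isPositive`, `galerkin_convergence`, half of
  `lerayProjector_comm_galerkinProj` and the eigenvector clause of `stokes_eigenbasis_complete`
  are assembled from the accepted (sorried) F7 API. The remaining clauses (density of the Stokes
  modes, existence of the eigenbasis) are literature theorems, `sorry`.
* Self-adjointness is stated for `Torus.stokesOperatorH d`, the Stokes operator as a `LinearPMap`
  *in the Hilbert space `H`* (accepted F7 design): a self-adjoint `LinearPMap` has dense domain
  (Mathlib `IsSelfAdjoint.dense_domain`) and `D(A) = H ∩ H²` is dense in `H` but not in `L²`.
  Positivity is recorded for both versions.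
* Declaration names follow the architect's outline (`energySpaceV_eq`, `galerkin_convergence`, …)
  rather than the statement-shaped Mathlib names (`mem_energySpaceV_iff`, `tendsto_galerkinProj`)
  so that the planned-declaration list matches; the accepted prelude carries the Mathlib-style
  names.
* In `exists_hilbertBasis_stokes` the index type of the Hilbert basis is quantified
  existentially in `Type` (`∃ ι : Type, …`) rather than fixed to `ℕ`: for `2 ≤ |d|` the space
  `H` is separable and infinite-dimensional and `ι = ℕ` works (the enumeration `w_1, w_2, …` of
  Constantin–Foias (4.13)), but for `|d| ≤ 1` mean-zero divergence-free fields on `T^d` vanish,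
  `H = 0`, and only an empty index type carries a Hilbert basis. The existential form is correct
  in every dimension and is what the outline prescribes.
* `stokesModes d` (the set of Stokes eigenfields with `k ≠ 0`, `0 ≠ a ⊥ k`) is the only new
  definition; it merely names the family whose density `stokes_eigenbasis_complete` asserts.

## References

* P. Constantin, C. Foias, *Navier–Stokes Equations* (Univ. Chicago Press, 1988), Ch. 4,
  Prop. 4.3 and (4.11)–(4.14).
* R. Temam, *Navier–Stokes Equations. Theory and Numerical Analysis* (North-Holland, 1977),
  Ch. I, §1.4 (Thm. 1.4, Rem. 1.6) and §2 (§2.6, the Stokes operator in the periodic case).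
-/

noncomputable section

open MeasureTheory TopologicalSpace Filter
open scoped InnerProductSpace RealInnerProductSpace ENNReal Topology

namespace Literature.Analysis.FluidPDE

section NS

variable {d : Type*} [Fintype d] [DecidableEq d]

/-- Local notation for the real Hilbert space `L²(T^d; ℝ^d)` of square-integrable vector fields
on the flat torus. -/
local notation "L2T" => Lp (EuclideanSpace ℝ d) 2 (volume : Measure (UnitAddTorus d))

/-! ### `H` and `V` -/

/-- **ns.S33** (energy space on the torus; Constantin–Foias 1988, Ch. 4, Prop. 4.3; Temam 1977,
Ch. I Thm. 1.4 / Rem. 1.6, periodic case). The energy space `H = Torus.energySpace d` (the `L²`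
closure of the smooth solenoidal mean-zero fields) is exactly the space of `L²` vector fields on
`T^d` that are weakly divergence free and have zero mean:
`v ∈ H ↔ (∀ θ smooth, ∫ ⟪v, ∇θ⟫ = 0) ∧ ∫ v = 0`. Restates the accepted
`Torus.mem_energySpace_iff` (a named fact of `TorusSobolevSpace`, of which this is literally the
statement) under the inventory id. [cite: ConstantinFoias1988, Ch. 4, Prop. 4.3] -/
def energySpace_characterisation : Prop :=
  ∀ (v : L2T),
    v ∈ FunctionSpaces.Torus.energySpace d ↔
      FunctionSpaces.Torus.IsWeaklyDivFree (v : UnitAddTorus d → EuclideanSpace ℝ d) ∧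
        FunctionSpaces.Torus.HasZeroMean (v : UnitAddTorus d → EuclideanSpace ℝ d)

/-- `energySpace_characterisation` *is* the prelude fact `Torus.mem_energySpace_iff`
(definitional). [folklore] -/
theorem energySpace_characterisation_iff :
    energySpace_characterisation (d := d) ↔ FunctionSpaces.Torus.mem_energySpace_iff (d := d) :=
  Iff.rfl

/-- **ns.S33** (`V = H ∩ H¹`; Constantin–Foias 1988, Ch. 4, Def. of `V`; Temam 1977, Ch. I
§1.4). A field lies in `V = Torus.energySpaceV d` iff it lies in `H` and has one spectral
derivative in `L²` (`Torus.MemSobolev 1` of its componentwise complexification). Definitional. [cite: ConstantinFoias1988, Ch. 4, Def. of V] -/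
theorem energySpaceV_eq (v : L2T) :
    v ∈ FunctionSpaces.Torus.energySpaceV d ↔
      v ∈ FunctionSpaces.Torus.energySpace d ∧
        FunctionSpaces.Torus.MemSobolev 1
          (FunctionSpaces.EuclideanSpace.complexify ∘ (v : UnitAddTorus d → EuclideanSpace ℝ d)) :=
  Iff.rfl

/-! ### The Stokes operator -/

/-- **ns.S33** (the Stokes operator `A = -P Δ` is self-adjoint and positive; Constantin–Foias
1988, Ch. 4, (4.11)–(4.12); Temam 1977, Ch. I §2.6). On `T^d`, the Stokes operator *in the
Hilbert space `H`*, `A = Torus.stokesOperatorH d` (domain `D(A) = H ∩ H²`, `A v = -Δ v`),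
satisfies `A† = A` (Mathlib's `LinearPMap.adjoint` / `IsSelfAdjoint`, meaningful only in `H`
where `D(A)` is dense) and `⟪v, A v⟫ = ‖∇v‖² ≥ 0` (H21 `LinearPMap.IsPositive`); the
`L²`-valued version `Torus.stokesOperator d` is positive as well. The conjunction of the F7
prelude results `Torus.isSelfAdjoint_stokesOperatorH`, `Torus.isPositive_stokesOperatorH`,
`Torus.isPositive_stokesOperator` (unproved there), recorded under the inventory id as a named
fact. [cite: Temam1977, Ch. I §2.6] -/
def stokesOperator_isSelfAdjoint_isPositive : Prop :=
  IsSelfAdjoint (Torus.stokesOperatorH d) ∧ (Torus.stokesOperatorH d).IsPositive ∧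
    (Torus.stokesOperator d).IsPositive

variable (d) in
/-- The set of Stokes eigenfields in `L²(T^d; ℝ^d)`: the classes of `a cos(2π k·x)` and
`a sin(2π k·x)` for `k ∈ ℤ^d ∖ {0}` and non-zero amplitude `a ⊥ k`
(Constantin–Foias 1988, Ch. 4, (4.13); Temam 1977, Ch. I §2.6). [cite: ConstantinFoias1988, Ch. 4, (4.13)] -/
def stokesModes : Set L2T :=
  {w | ∃ (k : d → ℤ) (a : EuclideanSpace ℝ d) (c : Bool),
    k ≠ 0 ∧ a ≠ 0 ∧ ⟪FunctionSpaces.Torus.latticeVec k, a⟫_ℝ = 0 ∧ w = Torus.stokesModeL2 k a c}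

/-- **ns.S33** (completeness of the Stokes eigenbasis; Constantin–Foias 1988, Ch. 4,
(4.13)–(4.14); Temam 1977, Ch. I §2.6). Every Stokes mode `a cos(2π k·x)`, `a sin(2π k·x)`
(`k ≠ 0`, `0 ≠ a ⊥ k`) is an eigenvector of the Stokes operator with eigenvalue `4π²|k|²`
(H21 `LinearPMap.HasEigenvector`), the modes lie in `H`, and their span is dense in `H`: the
`L²` closure of `span (stokesModes d)` is `Torus.energySpace d`. [cite: ConstantinFoias1988, Ch. 4, (4.13)–(4.14)] -/
def stokes_eigenbasis_complete : Prop :=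
  (∀ w ∈ stokesModes d, ∃ k : d → ℤ, k ≠ 0 ∧
        (Torus.stokesOperator d).HasEigenvector (Torus.stokesEigenvalue k) w) ∧
      stokesModes d ⊆ (FunctionSpaces.Torus.energySpace d : Set L2T) ∧
      (Submodule.span ℝ (stokesModes d)).topologicalClosure = FunctionSpaces.Torus.energySpace d

/- interim partial proof (harness21 @ d8f2665), preserved for route work:
:= by
  have hdense : (Submodule.span ℝ (stokesModes d)).topologicalClosure = Torus.energySpace d := by
    sorry
  refine ⟨fun w ⟨k, a, c, hk, ha, hka, hw⟩ => ⟨k, hk, ?_⟩, ?_, hdense⟩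
  · rw [hw]
    exact Torus.hasEigenvector_stokesOperator_stokesModeL2 hk ha hka c
  · rw [← hdense]
    exact Submodule.subset_span.trans (Submodule.le_topologicalClosure _)
-/

/-- **ns.S33** (the Stokes operator is diagonal in an orthonormal eigenbasis; Constantin–Foias
1988, Ch. 4, (4.13)–(4.14): `A w_j = λ_j w_j`, `{w_j}` an orthonormal basis of `H`,
`0 < λ_1 ≤ λ_2 ≤ ⋯`; Temam 1977, Ch. I §2.6). There is a Hilbert basis `b` of
`H = Torus.energySpace d` consisting of Stokes modes in `stokesModes d` (`k ≠ 0`,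
`0 ≠ a ⊥ k`), with symbol `m i = 4π²|k|² > 0` and `m i → ∞` along the cofinite filter, in
particular satisfying the hypotheses of the accepted bridge
`Torus.stokesOperatorH_eq_diagonalPMap`; consequently the Stokes operator in `H` *is* the
maximal diagonal operator `b.diagonalPMap m` of the UnbddOp trunk, and the `L²`-valued
`Torus.stokesOperator d` has the same domain and values. The index type is quantified in `Type`
(it is `ℕ` as soon as `2 ≤ |d|`; in the degenerate dimensions `|d| ≤ 1`, where `H = 0`, it is
empty). [cite: Temam1977, Ch. I §2.6] -/
def exists_hilbertBasis_stokes : Prop :=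
  ∃ (ι : Type) (b : HilbertBasis ι ℝ (FunctionSpaces.Torus.energySpace d)) (m : ι → ℝ),
      (∀ i, ∃ (k : d → ℤ) (a : EuclideanSpace ℝ d) (c : Bool),
        k ≠ 0 ∧ a ≠ 0 ∧ ⟪FunctionSpaces.Torus.latticeVec k, a⟫_ℝ = 0 ∧
          ((b i : FunctionSpaces.Torus.energySpace d) : L2T) = Torus.stokesModeL2 k a c ∧
          m i = Torus.stokesEigenvalue k) ∧
      (∀ i, 0 < m i) ∧ Tendsto m cofinite atTop ∧
      Torus.stokesOperatorH d = b.diagonalPMap m ∧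
      ∀ v : FunctionSpaces.Torus.energySpace d,
        ((v : L2T) ∈ (Torus.stokesOperator d).domain ↔ v ∈ b.diagonalDomain m) ∧
          ∀ (hv : (v : L2T) ∈ (Torus.stokesOperator d).domain) (hv' : v ∈ b.diagonalDomain m),
            Torus.stokesOperator d ⟨v, hv⟩ =
              ((b.diagonalPMap m ⟨v, hv'⟩ : FunctionSpaces.Torus.energySpace d) : L2T)

/-! ### Galerkin truncations -/

/-- **ns.S33** (convergence of the Galerkin truncations; Constantin–Foias 1988, Ch. 4, (4.14):
`P_m u → u` in `H`; Temam 1977, Ch. I §2.6 / Ch. III §3). For every `v ∈ H`, the Galerkin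
projections `P_N v = Torus.galerkinProj N v` converge to `v` in `L²(T^d; ℝ^d)` as `N → ∞`.
Restates the F7 prelude result `Torus.tendsto_galerkinProj` (unproved there) under the inventory
id, as a named fact. [cite: ConstantinFoias1988, Ch. 4, (4.14)] -/
def galerkin_convergence : Prop :=
  ∀ v ∈ FunctionSpaces.Torus.energySpace d, Tendsto (fun N => Torus.galerkinProj (d := d) N v) atTop (𝓝 v)

/-- **ns.S33** (the Galerkin projections commute with the Leray projector; Constantin–Foias
1988, Ch. 4, (4.14); Temam 1977, Ch. III §3). Since `galerkinSpace N ≤ H`, the orthogonal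
projections `P_N` onto `galerkinSpace N` and `P` onto `H` satisfy `P P_N = P_N P = P_N`. The two
F7 prelude inputs that are unproved there — `galerkinSpace N ≤ H`
(`Torus.galerkinSpace_le_energySpace`) and `P_N P = P_N` (`Torus.galerkinProj_comp_lerayProjector`)
— are taken as the explicit witnesses `hle`, `hcomp`; `P P_N = P_N` is then a real consequence of
`Torus.lerayProjector_eq_self_of_mem`. [cite: Temam1977, Ch. III §3] -/
theorem lerayProjector_comm_galerkinProj
    (hle : ∀ N : ℕ, Torus.galerkinSpace (d := d) N ≤ FunctionSpaces.Torus.energySpace d)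
    (hcomp : ∀ N : ℕ,
      (Torus.galerkinProj (d := d) N).comp (Torus.lerayProjector d) = Torus.galerkinProj N)
    (N : ℕ) :
    (Torus.lerayProjector d).comp (Torus.galerkinProj (d := d) N) = Torus.galerkinProj N ∧
      (Torus.galerkinProj (d := d) N).comp (Torus.lerayProjector d) = Torus.galerkinProj N := by
  refine ⟨?_, hcomp N⟩
  ext1 v
  exact Torus.lerayProjector_eq_self_of_mem (hle N (Torus.galerkinProj_apply_mem N v))

end NS

end Literature.Analysis.FluidPDE
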